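import Summits.AtomisticToContinuum.FouriersLaw.Theses.JunctionLocality
import Literature.MathematicalPhysics.KineticTheory.LangevinChainKernel
import Literature.MathematicalPhysics.KineticTheory.LangevinChainGibbs

/-!
# Route `JunctionLocality` — posited objects (vocabulary of the crux lines of `NonBallistic`)

Definitions file of route `JunctionLocality` (sub-problem `FouriersLaw`, summit `AtomisticToContinuum`),
opened by the line lead of crux `NonBallistic` (stmt-AtomisticToContinuum-9127, line
`contact-current-forgetting`). It fixes, once, the KERNEL-LEVEL equilibrium vocabulary of the open chain with
both Langevin baths at the same temperature `T` — the constructed transition kernels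
`OscillatorChain.transitionKernel N T T s` (`LangevinChainKernel.lean`) acting on observables, and Gibbs
expectations against `OscillatorChain.gibbsMeasure N T` (`LangevinChainGibbs.lean`) — in which the line's stubs
are registered and landed (`Theorems/JunctionLocalityNonBallistic*.lean`), so that the stub files state short
signatures over shared names instead of carrying private copies:

* `evolve P N T g s z = ∫ g d(P.transitionKernel N T T s⁺ z)` — the kernel `κ_s` acting on an observable
  (real time clamped at `0⁺` by `Real.toNNReal`, as in every route file of the sub-problem);
* `bondCurrentAt P N b` — the bond current `j_b` with a natural-number bond index (`0` if there is no bond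
  `(b, b+1)`), and `totalCurrentObs P N = Σ_i j_i` (so that `P.totalCurrent μ = ∫ totalCurrentObs dμ`
  whenever the bond currents are `μ`-integrable);
* `gkEntry P N T b b' t = ⟨j_b, κ_t j_{b'}⟩_{μ_T}` — the Green–Kubo matrix integrand of the open chain;
* `totalCorr P N T t = ⟨J, κ_t J⟩_{μ_T} − μ_T(J)²` — the total-current autocorrelation, VERBATIM the
  `let`-bound `corrJJ` of the route item `HonestZwanzig.OpenChainGreenKubo` (stmt-AtomisticToContinuum-12696)
  and the integrand of `HonestZwanzig.MemoryConductivity`, as a closed term;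
* `contactProfile P N T s = ‖κ_s j_0‖²_{L²(μ_T)} + ‖κ_s j_{N-2}‖²_{L²(μ_T)}` — the (left–right symmetric) contraction
  profile of the two contact currents.

Everything is an explicit abbreviation of tree objects (Bochner integrals against constructed kernels and the
Gibbs measure); nothing carries axioms; no statement of the route is restated and no proposition is defined.
Elementary `rfl` / unfolding facts about the vocabulary are recorded next to it.
-/

noncomputable section

namespace Summit.AtomisticToContinuum.FouriersLaw.Theorems.JunctionLocality

open MeasureTheory
open scoped NNReal BigOperators
open Literature.MathematicalPhysics.KineticTheory.HeatConduction

/-- `(κ_s g)(z) = ∫ g dP_s(z,·)`: the constructed equal-temperature transition kernel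
`P.transitionKernel N T T s⁺` (both baths at `T`; real time clamped at `0⁺`) acting on an observable `g`. -/
def evolve (P : OscillatorChain) (N : ℕ) (T : ℝ) (g : PhaseSpace N → ℝ) (s : ℝ) (z : PhaseSpace N) : ℝ :=
  ∫ y, g y ∂(P.transitionKernel N T T s.toNNReal z)

/-- The energy current `j_b` through the bond `(b, b+1)` with a natural-number bond index: `P.bondCurrent N i`
summed over the (at most one) site `i` with `i.val = b`; it is `0` when `N ≤ b + 1` (no such bond). -/
def bondCurrentAt (P : OscillatorChain) (N b : ℕ) (z : PhaseSpace N) : ℝ :=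
  ∑ i : Fin N, if i.val = b then P.bondCurrent N i z else 0

/-- The total-current observable `J = Σ_i j_i` (`P.totalCurrent μ = ∫ J dμ` whenever the bond currents are
`μ`-integrable, `totalCurrent_eq_integral_totalCurrentObs`). -/
def totalCurrentObs (P : OscillatorChain) (N : ℕ) (z : PhaseSpace N) : ℝ :=
  ∑ i : Fin N, P.bondCurrent N i z

/-- The Green–Kubo matrix integrand of the open chain at equilibrium,
`M_N(b,b')(t) = ⟨j_b, κ_t j_{b'}⟩_{μ_T} = ∫ j_b · (κ_t j_{b'}) dμ_T` (no centring: `μ_T(j_b) = 0` by momentum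
parity, `pinnedChain_integral_bondCurrent_gibbsMeasure`). -/
def gkEntry (P : OscillatorChain) (N : ℕ) (T : ℝ) (b b' : ℕ) (t : ℝ) : ℝ :=
  ∫ z, bondCurrentAt P N b z * evolve P N T (bondCurrentAt P N b') t z ∂(P.gibbsMeasure N T)

/-- The total-current autocorrelation `corr(J,J)(t) = ∫ J · (κ_t J) dμ_T − μ_T(J)·μ_T(J)` — verbatim the
`let`-bound `corrJJ` of `HonestZwanzig.OpenChainGreenKubo` (stmt-AtomisticToContinuum-12696) once its `let`s are
unfolded (`totalCorr_eq`). -/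
def totalCorr (P : OscillatorChain) (N : ℕ) (T : ℝ) (t : ℝ) : ℝ :=
  (∫ z, totalCurrentObs P N z * evolve P N T (totalCurrentObs P N) t z ∂(P.gibbsMeasure N T)) -
    (∫ z, totalCurrentObs P N z ∂(P.gibbsMeasure N T)) * (∫ z, totalCurrentObs P N z ∂(P.gibbsMeasure N T))

/-- The contraction profile of the two contact currents,
`φ_N(s) = ‖κ_s j_0‖²_{L²(μ_T)} + ‖κ_s j_{N-2}‖²_{L²(μ_T)} = ∫ (κ_s j_0)² + (κ_s j_{N-2})² dμ_T` (the `μ_T`-second moments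
of the conditional expectations of the two contact currents a time `s` ahead; written symmetrically in the two ends so
that no left–right reflection symmetry of the kernels is ever needed; the two summands agree by that symmetry). -/
def contactProfile (P : OscillatorChain) (N : ℕ) (T : ℝ) (s : ℝ) : ℝ :=
  ∫ z, ((evolve P N T (bondCurrentAt P N 0) s z) ^ 2 + (evolve P N T (bondCurrentAt P N (N - 2)) s z) ^ 2)
    ∂(P.gibbsMeasure N T)

/-! ### Unfolding lemmas -/

/-- Unfolding `evolve`. -/
theorem evolve_def (P : OscillatorChain) (N : ℕ) (T : ℝ) (g : PhaseSpace N → ℝ) (s : ℝ) (z : PhaseSpace N) :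
    evolve P N T g s z = ∫ y, g y ∂(P.transitionKernel N T T s.toNNReal z) := rfl

/-- Unfolding `bondCurrentAt`. -/
theorem bondCurrentAt_def (P : OscillatorChain) (N b : ℕ) (z : PhaseSpace N) :
    bondCurrentAt P N b z = ∑ i : Fin N, if i.val = b then P.bondCurrent N i z else 0 := rfl

/-- Unfolding `totalCurrentObs`. -/
theorem totalCurrentObs_def (P : OscillatorChain) (N : ℕ) (z : PhaseSpace N) :
    totalCurrentObs P N z = ∑ i : Fin N, P.bondCurrent N i z := rfl

/-- Unfolding `gkEntry`. -/
theorem gkEntry_def (P : OscillatorChain) (N : ℕ) (T : ℝ) (b b' : ℕ) (t : ℝ) :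
    gkEntry P N T b b' t =
      ∫ z, bondCurrentAt P N b z * evolve P N T (bondCurrentAt P N b') t z ∂(P.gibbsMeasure N T) := rfl

/-- Unfolding `totalCorr`. -/
theorem totalCorr_def (P : OscillatorChain) (N : ℕ) (T : ℝ) (t : ℝ) :
    totalCorr P N T t =
      (∫ z, totalCurrentObs P N z * evolve P N T (totalCurrentObs P N) t z ∂(P.gibbsMeasure N T)) -
        (∫ z, totalCurrentObs P N z ∂(P.gibbsMeasure N T)) *
          (∫ z, totalCurrentObs P N z ∂(P.gibbsMeasure N T)) := rfl

/-- Unfolding `contactProfile`. -/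
theorem contactProfile_def (P : OscillatorChain) (N : ℕ) (T : ℝ) (s : ℝ) :
    contactProfile P N T s =
      ∫ z, ((evolve P N T (bondCurrentAt P N 0) s z) ^ 2 + (evolve P N T (bondCurrentAt P N (N - 2)) s z) ^ 2)
        ∂(P.gibbsMeasure N T) := rfl

/-- `bondCurrentAt` at a bond index carried by a site is that site's `bondCurrent`. -/
theorem bondCurrentAt_eq_bondCurrent (P : OscillatorChain) {N b : ℕ} (hb : b < N) (z : PhaseSpace N) :
    bondCurrentAt P N b z = P.bondCurrent N ⟨b, hb⟩ z := by
  unfold bondCurrentAt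
  rw [Finset.sum_eq_single ⟨b, hb⟩]
  · simp
  · intro i _ hi
    have : i.val ≠ b := fun h => hi (Fin.ext h)
    simp [this]
  · intro h; exact absurd (Finset.mem_univ _) h

/-- `bondCurrentAt` vanishes when there is no site with that index. -/
theorem bondCurrentAt_eq_zero_of_le (P : OscillatorChain) {N b : ℕ} (hb : N ≤ b) (z : PhaseSpace N) :
    bondCurrentAt P N b z = 0 := by
  unfold bondCurrentAt
  refine Finset.sum_eq_zero fun i _ => ?_
  have : i.val ≠ b := by have := i.isLt; omega
  simp [this]

/-- The total-current observable is the sum of the `bondCurrentAt` over the bond indices `0, …, N-1`. -/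
theorem totalCurrentObs_eq_sum_bondCurrentAt (P : OscillatorChain) (N : ℕ) (z : PhaseSpace N) :
    totalCurrentObs P N z = ∑ b ∈ Finset.range N, bondCurrentAt P N b z := by
  unfold totalCurrentObs
  rw [Finset.sum_fin_eq_sum_range]
  refine Finset.sum_congr rfl fun b hb => ?_
  rw [Finset.mem_range] at hb
  rw [dif_pos hb, bondCurrentAt_eq_bondCurrent P hb]

/-- `P.totalCurrent μ = ∫ J dμ` as soon as the bond currents are `μ`-integrable (e.g. in a weak steady
state, clause 3 of `IsSteadyState`). -/
theorem totalCurrent_eq_integral_totalCurrentObs :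
    ∀ (P : OscillatorChain) (N : ℕ) (μ : Measure (PhaseSpace N)),
      (∀ i : Fin N, Integrable (P.bondCurrent N i) μ) → P.totalCurrent μ = ∫ z, totalCurrentObs P N z ∂μ := by
  intro P N μ h
  unfold OscillatorChain.totalCurrent totalCurrentObs
  rw [integral_finsetSum _ fun i _ => h i]

/-- The contraction profile is nonnegative (integral of a square). -/
theorem contactProfile_nonneg (P : OscillatorChain) (N : ℕ) (T s : ℝ) : 0 ≤ contactProfile P N T s :=
  integral_nonneg fun _ => add_nonneg (sq_nonneg _) (sq_nonneg _)

/-- For nonpositive times the kernel is the identity (`Real.toNNReal s = 0`, `transitionKernel … 0 = id` for the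
pinned chain), so `evolve` returns the observable itself. -/
theorem pinnedChain_evolve_of_nonpos {ω₂ lam β γ : ℝ} (hω : 0 < ω₂) (hl : 0 ≤ lam) (hβ : 0 ≤ β)
    (hγ : 0 ≤ γ) (N : ℕ) (T : ℝ) (g : PhaseSpace N → ℝ) {s : ℝ} (hs : s ≤ 0) (z : PhaseSpace N) :
    evolve (pinnedChain ω₂ lam β γ) N T g s z = g z := by
  unfold evolve
  rw [Real.toNNReal_of_nonpos hs, pinnedChain_transitionKernel_zero hω hl hβ hγ N T T]
  simp [ProbabilityTheory.Kernel.id_apply, integral_dirac]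

/-! ### Kick-dipole vocabulary (crux `ConductanceLowerBound`, stmt-AtomisticToContinuum-11749, line `kick-dipole-no-collapse`)

The Kundu–Dhar–Narayan reading of the finite-length response coefficient `D_N` as the terminal value of ONE
bounded response curve per length: the antisymmetric contact kick `g = (γ/2)(p_0² − p_{N−1}²)` (the source of
`kdn_identity` / `totalCurrent_eq_bias_mul_pairing`, `Theorems/HonestZwanzigOpenChainGreenKubo{KDN,Star}.lean`),
its kick-response kernel `𝒥_N(s) = T⁻² ∫ g · (κ_s J) dμ_T` and the booked heat dipole `𝔇_N(t) = ∫₀ᵗ 𝒥_N`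
(Kundu–Dhar–Narayan 2009, p. 3: the integrand of their `D_l` BEFORE the Green–Kubo conversion).  Registered stubs
of the line are stated over these names (`Cruxes/ConductanceLowerBound/Lines/kick_dipole_no_collapse.lean`). -/

/-- The Kundu–Dhar–Narayan SOURCE `g = (γ/2)(p_0² − p_{N−1}²)` of the chain `P` (antisymmetric kinetic-energy
kick at the two contacts, `γ = P.γ` the bath coupling); `0` on the empty chain.  For `0 < N` it is verbatim the
source of `kdn_identity` (`kdnSource_of_pos`). -/
def kdnSource (P : OscillatorChain) (N : ℕ) (x : PhaseSpace N) : ℝ :=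
  if h : 0 < N then P.γ / 2 * (x.2 ⟨0, h⟩ ^ 2 - x.2 ⟨N - 1, by omega⟩ ^ 2) else 0

/-- The KICK-RESPONSE KERNEL `𝒥_N(s) = T⁻² ∫ g(z) · (κ_s J)(z) dμ_T(z)`: the mean total current `J = Σ_i j_i`
(`totalCurrentObs`) a time `s` after the contact kick `g = kdnSource`, in equilibrium at `T` (equal-temperature
kernels `evolve`, Gibbs measure `P.gibbsMeasure N T`).  Since `μ_T(J) = 0` this is
`(γ/2T²)·Cov_{μ_T}(p_0(0)² − p_{N−1}(0)², J(s))`. -/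
def kickKernel (P : OscillatorChain) (N : ℕ) (T s : ℝ) : ℝ :=
  1 / T ^ 2 * ∫ z, kdnSource P N z * evolve P N T (totalCurrentObs P N) s z ∂(P.gibbsMeasure N T)

/-- The BOOKED HEAT DIPOLE `𝔇_N(t) = ∫₀ᵗ 𝒥_N(s) ds` (time-integrated total-current response to the contact kick;
an interval integral, so `𝔇_N(t) = −∫_t^0 𝒥_N` for `t < 0`, where `𝒥_N(s) = 𝒥_N(0)` by the time clamp). -/
def bookedDipole (P : OscillatorChain) (N : ℕ) (T t : ℝ) : ℝ :=
  ∫ s in (0 : ℝ)..t, kickKernel P N T s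

/-- Unfolding `kdnSource`. -/
theorem kdnSource_def (P : OscillatorChain) (N : ℕ) (x : PhaseSpace N) :
    kdnSource P N x = if h : 0 < N then P.γ / 2 * (x.2 ⟨0, h⟩ ^ 2 - x.2 ⟨N - 1, by omega⟩ ^ 2) else 0 := rfl

/-- `kdnSource` on a nonempty chain. -/
theorem kdnSource_of_pos (P : OscillatorChain) {N : ℕ} (hN : 0 < N) (x : PhaseSpace N) :
    kdnSource P N x = P.γ / 2 * (x.2 ⟨0, hN⟩ ^ 2 - x.2 ⟨N - 1, by omega⟩ ^ 2) := by
  simp [kdnSource, hN]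

/-- `kdnSource` of the empty chain is `0`. -/
theorem kdnSource_zero (P : OscillatorChain) (x : PhaseSpace 0) : kdnSource P 0 x = 0 := by
  simp [kdnSource]

/-- `kdnSource` is even under the momentum flip. -/
theorem kdnSource_neg_momentum (P : OscillatorChain) (N : ℕ) (x : PhaseSpace N) :
    kdnSource P N (x.1, -x.2) = kdnSource P N x := by
  unfold kdnSource
  split_ifs <;> simp

/-- Unfolding `kickKernel` down to the tree's kernels: `𝒥_N(s) = T⁻² ∫ g · (∫ J dκ_s) dμ_T`. -/
theorem kickKernel_def (P : OscillatorChain) (N : ℕ) (T s : ℝ) :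
    kickKernel P N T s = 1 / T ^ 2 * ∫ z, kdnSource P N z *
      (∫ y, (∑ i : Fin N, P.bondCurrent N i y) ∂(P.transitionKernel N T T s.toNNReal z)) ∂(P.gibbsMeasure N T) :=
  rfl

/-- Unfolding `bookedDipole`. -/
theorem bookedDipole_def (P : OscillatorChain) (N : ℕ) (T t : ℝ) :
    bookedDipole P N T t = ∫ s in (0 : ℝ)..t, kickKernel P N T s := rfl

/-- `𝔇_N(0) = 0`. -/
@[simp] theorem bookedDipole_zero (P : OscillatorChain) (N : ℕ) (T : ℝ) : bookedDipole P N T 0 = 0 := by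
  simp [bookedDipole]

/-- The increment of the booked dipole is the integral of the kernel over the window:
`𝔇_N(t) − 𝔇_N(τ) = ∫_τ^t 𝒥_N` whenever `𝒥_N` is interval-integrable on both windows. -/
theorem bookedDipole_sub :
    ∀ (P : OscillatorChain) (N : ℕ) (T : ℝ) {τ t : ℝ}, IntervalIntegrable (kickKernel P N T) volume 0 τ →
      IntervalIntegrable (kickKernel P N T) volume τ t →
      bookedDipole P N T t - bookedDipole P N T τ = ∫ s in τ..t, kickKernel P N T s := by
  intro P N T τ t hτ ht
  unfold bookedDipole
  rw [← intervalIntegral.integral_add_adjacent_intervals hτ ht]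
  ring

end Summit.AtomisticToContinuum.FouriersLaw.Theorems.JunctionLocality

end
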